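import Summits.CriticalPhenomena.PercolationContinuityZ3.Theorems.PercNearOneGluingNoHeavyPcintBSMXSiteAssembly
import Summits.CriticalPhenomena.PercolationContinuityZ3.Theorems.PercNearOneGluingNoHeavyPcintBSMXKernel
import Summits.CriticalPhenomena.PercolationContinuityZ3.Theorems.PercNearOneGluingNoHeavyPcintBSMXSym2
import HarnessLib

/-!
# PCINT lane, PHASE 8 (block renewal, SITE version), step 4: the site kernel theorem

Cell `prim-pcint`, seat `prim-pcint-1` (gen 16); memo `run/shared/lean/prim/pcint/T-FIBRE-ROUTE.md` §PHASE 8.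

The SITE analogue of …PcintBSMXKernel: the integer certificate functional **`BSMX.certLHSVz`** (the bond one
`BSM.certLHSz` without the shared-time-edge term: exponent `SV` in both branches), its cast to `BSMX.certLHSV`
(`BSMX.certLHSVz_cast`), the fast shared-vertex count with integer-pair keys (**`BSMX.SV2`**, `BSMX.SV_eq_SV2`) and
**`BSMX.siteCriticalProb_le_of_checks5V`**: the decidable hypotheses of `BSMX.criticalProb_le_of_checks5` with
`KeyCube2 ↦ VertCube2`, `S ↦ SV`, `certLHSz ↦ certLHSVz` imply `p_c^site(ℤ^{k+t}) ≤ P/10^4`.  The Green tables, the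
marginal identity, the potential-table checks and the tail bound are literally those of the bond instances.
-/

noncomputable section

namespace Summit.CriticalPhenomena.PercolationContinuityZ3.Theorems.Pcint.BSMX

open Finset OSM BSM Literature.Probability.Percolation Literature.Probability.LatticeModels

variable {t k np : ℕ}

/-! ### The integer site functional -/

/-- The entered vertices of a piece are at most as many as its steps. -/
theorem card_tverts_le (k : ℕ) : ∀ (u : Fin t → ℤ) (σ : List (Fin t × Bool)), (tverts k u σ).card ≤ σ.length
  | u, [] => by simp [tverts]
  | u, q :: σ => by
    rw [tverts, List.length_cons]
    exact (Finset.card_insert_le _ _).trans (by have := card_tverts_le k (u + sv q) σ; omega)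

/-- `SV ≤ |σ| + 1`. -/
theorem SV_le_length (pc : Fin np → List (Fin t × Bool)) (k : ℕ) (y : Fin t → ℤ) (σ σ' : Fin np) :
    SV pc k y σ σ' ≤ (pc σ).length + 1 := by
  unfold SV
  refine (Finset.card_le_card Finset.inter_subset_left).trans ((Finset.card_insert_le _ _).trans ?_)
  have := card_tverts_le k 0 (pc σ); omega

/-- **The integer site certificate functional** (denominators cleared; exponent `SV` in both branches). -/
def certLHSVz (pe : Fin np → (Fin t → ℤ)) (St : (Fin t → ℤ) → Fin np → Fin np → ℕ) (W : Fin np → ℕ) (k A B E : ℕ)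
    (V0n V1n : (Fin t → ℤ) → ℕ) (y : Fin t → ℤ) : ℤ :=
  ∑ σ : Fin np, ∑ σ' : Fin np,
    let s := St y σ σ'
    let uo := y + (pe σ' - pe σ)
    ((W σ * W σ' : ℕ) : ℤ) *
      ((((A ^ s * B ^ (E - s) : ℕ) : ℤ) - ((B ^ E : ℕ) : ℤ)) * ((V0n uo : ℕ) : ℤ) +
        ((k - 1 : ℕ) : ℤ) * ((((A ^ s * B ^ (E - s) : ℕ) : ℤ) - ((B ^ E : ℕ) : ℤ)) * ((V1n uo : ℕ) : ℤ)))

/-- **`certLHSVz` is `certLHSV` with denominators cleared** (factor `k · B^E · DW² · DV`). -/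
theorem certLHSVz_cast (pc : Fin np → List (Fin t × Bool)) {pe : Fin np → (Fin t → ℤ)} (hpe : ∀ σ, pe σ = pend (pc σ))
    (W : Fin np → ℕ) {k : ℕ} (hk : 1 ≤ k) (A : ℕ) {B E : ℕ} (hB : 0 < B) (hE : ∀ σ, (pc σ).length + 1 ≤ E)
    (V0n V1n : (Fin t → ℤ) → ℕ) (y : Fin t → ℤ) {DW DV : ℕ} (hDW : 0 < DW) (hDV : 0 < DV) :
    ((certLHSVz pe (SV pc k) W k A B E V0n V1n y : ℤ) : ℝ) =
      certLHSV pc (fun σ => (W σ : ℝ) / DW) k ((A : ℝ) / B) (fun u => (V0n u : ℝ) / DV) (fun u => (V1n u : ℝ) / DV) y *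
        ((k : ℝ) * (B : ℝ) ^ E * (DW : ℝ) ^ 2 * DV) := by
  have hBR : (0 : ℝ) < B := by exact_mod_cast hB
  unfold certLHSVz certLHSV
  simp only [hpe]
  rw [Finset.sum_mul]
  push_cast
  refine sum_congr rfl fun σ _ => ?_
  rw [Finset.sum_mul]
  refine sum_congr rfl fun σ' _ => ?_
  have h1 : SV pc k y σ σ' ≤ E := (SV_le_length pc k y σ σ').trans (hE σ)
  have e1 := pow_pad (A := A) h1 hB
  push_cast at e1
  rw [e1]
  have hk' : ((k - 1 : ℕ) : ℝ) = (k : ℝ) - 1 := by rw [Nat.cast_sub hk]; simp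
  rw [hk']
  field_simp

/-! ### Fast shared-vertex counts with integer-pair keys -/

/-- Vertex keys with pair coordinates. -/
abbrev VKey2 (k : ℕ) := (Fin k → ℤ) × (ℤ × ℤ)

/-- Transport of vertex keys to pair coordinates. -/
def embV2 (k : ℕ) : VKey 2 k ↪ VKey2 k :=
  ⟨fun q => (q.1, tr2 q.2), fun q q' h => by
    simp only [Prod.mk.injEq] at h
    exact Prod.ext h.1 (tr2_injective h.2)⟩

/-- The entered vertices of a piece started at the pair `u` (mirror of `BSM.tverts`). -/
def tverts2 (k : ℕ) : ℤ × ℤ → List (Fin 2 × Bool) → Finset (VKey2 k)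
  | _, [] => ∅
  | u, q :: σ => insert (0, u + sv2 q) (tverts2 k (u + sv2 q) σ)

/-- `tverts2` is the transport of `tverts`. -/
theorem tverts_map_embV2 (k : ℕ) : ∀ (u : Fin 2 → ℤ) (σ : List (Fin 2 × Bool)),
    (tverts k u σ).map (embV2 k) = tverts2 k (tr2 u) σ
  | u, [] => by simp [tverts, tverts2]
  | u, q :: σ => by
    rw [tverts, tverts2, Finset.map_insert, tverts_map_embV2 k (u + sv q) σ, tr2_add]
    rfl

/-- Shift of pair vertex keys. -/
def shiftV2 (k : ℕ) (y : ℤ × ℤ) : VKey2 k ↪ VKey2 k :=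
  ⟨fun q => (q.1, q.2 + y), fun q q' h => by
    simp only [Prod.mk.injEq, add_left_inj] at h
    exact Prod.ext h.1 h.2⟩

/-- Transport commutes with shifting. -/
theorem shiftV_trans_embV2 (k : ℕ) (y : Fin 2 → ℤ) :
    (shiftV (k := k) y).trans (embV2 k) = (embV2 k).trans (shiftV2 k (tr2 y)) := by
  ext q <;> simp [shiftV, embV2, shiftV2, tr2_add, Function.Embedding.trans]

/-- **The fast shared-vertex count** (integer-pair coordinates). -/
def SV2 (pc : Fin np → List (Fin 2 × Bool)) (k : ℕ) (y : Fin 2 → ℤ) (σ σ' : Fin np) : ℕ :=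
  (insert ((0 : Fin k → ℤ), ((0 : ℤ), (0 : ℤ))) (tverts2 k (0, 0) (pc σ)) ∩
    (insert ((0 : Fin k → ℤ), ((0 : ℤ), (0 : ℤ))) (tverts2 k (0, 0) (pc σ'))).map (shiftV2 k (tr2 y))).card

/-- **`SV = SV2`.** -/
theorem SV_eq_SV2 (pc : Fin np → List (Fin 2 × Bool)) (k : ℕ) (y : Fin 2 → ℤ) (σ σ' : Fin np) :
    SV pc k y σ σ' = SV2 pc k y σ σ' := by
  unfold SV SV2
  rw [← Finset.card_map (embV2 k), Finset.map_inter, Finset.map_map, shiftV_trans_embV2, ← Finset.map_map,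
    Finset.map_insert, Finset.map_insert, tverts_map_embV2, tverts_map_embV2]
  rfl

/-! ### The site kernel theorem -/

/-- **`p_c^site(ℤ^{k+t}) ≤ P/10^4` from decidable checks** (integer site certificate). -/
theorem siteCriticalProb_le_of_checks5V (hk : 2 ≤ k) (pc : Fin np → List (Fin t × Bool))
    (pe : Fin np → (Fin t → ℤ)) (hpe : ∀ σ, pe σ = pend (pc σ)) (E : ℕ) (hE : ∀ σ, (pc σ).length + 1 ≤ E)
    (St : (Fin t → ℤ) → Fin np → Fin np → ℕ) (hSt : ∀ y ∈ boxList t 4, ∀ σ σ', St y σ σ' = SV pc k y σ σ')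
    (W : Fin np → ℕ) (DW : ℕ) (hDW : 0 < DW)
    {A1 A2 DA : ℕ}
    (hcube : Cube2 pc) (hvc : VertCube2 pc k)
    (hmarg : MargQ5 pc (fun σ => (W σ : ℚ) / DW) ((A1 : ℚ) / DA) ((A2 : ℚ) / DA)) {P : ℕ} (hP0 : 0 < P) (hP1 : P ≤ 10000)
    {N : ℕ} (DG DΦ Tn : ℕ) (hDG : 0 < DG) (hDΦ : 0 < DΦ)
    (hT : TailBoundH t k ((A1 : ℝ) / DA) ((A2 : ℝ) / DA) N ((Tn : ℝ) / DG))
    (G0n G1n V0n V1n Φn : (Fin t → ℤ) → ℕ) (CL : List (Fin t → ℤ)) (hCL : ∀ δ ∈ boxList t 12, canonK δ ∈ CL)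
    (hG0 : ∀ δ ∈ CL, G0H k ((A1 : ℝ) / DA) ((A2 : ℝ) / DA) N δ * DG ≤ G0n δ)
    (hG1 : ∀ δ ∈ CL, G1H k ((A1 : ℝ) / DA) ((A2 : ℝ) / DA) N δ * DG ≤ G1n δ)
    (hV0 : ∀ u ∈ boxList t 8, 1 + ((boxList t 4).map fun z => (G0n (canonK (z - u)) + Tn) * Φn z).sum ≤ V0n u)
    (hV1 : ∀ u ∈ boxList t 8, 1 + ((boxList t 4).map fun z => (G1n (canonK (z - u)) + Tn) * Φn z).sum ≤ V1n u)
    (hcert : ∀ y ∈ boxList t 4, certLHSVz pe St W k 10000 P E V0n V1n y * DΦ ≤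
      (Φn y : ℤ) * ((P ^ E * k * DW ^ 2 * (DG * DΦ) : ℕ) : ℤ)) :
    siteCriticalProb (zdGraph (k + t)) (0 : Site (k + t)) ≤ (P : ℝ) / 10000 := by
  have hPR : (0 : ℝ) < P := by exact_mod_cast hP0
  have hDGR : (0 : ℝ) < DG := by exact_mod_cast hDG
  have hDΦR : (0 : ℝ) < DΦ := by exact_mod_cast hDΦ
  have hDWR : (0 : ℝ) < DW := by exact_mod_cast hDW
  set a₁ : ℝ := (((A1 : ℚ) / DA : ℚ) : ℝ) with ha₁
  set a₂ : ℝ := (((A2 : ℚ) / DA : ℚ) : ℝ) with ha₂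
  have ha₁' : a₁ = (A1 : ℝ) / DA := by rw [ha₁]; push_cast; rfl
  have ha₂' : a₂ = (A2 : ℝ) / DA := by rw [ha₂]; push_cast; rfl
  have hp0 : (0 : ℝ) < (P : ℝ) / 10000 := by positivity
  have hp1 : (P : ℝ) / 10000 ≤ 1 := by rw [div_le_one (by norm_num)]; exact_mod_cast hP1
  -- the weights
  set w : Fin np → ℝ := fun σ => (W σ : ℝ) / DW with hw
  have hmarg' : Marg5 pc w a₁ a₂ := by
    have h := marg_of_margQ5 hmarg
    have : (fun σ => ((((W σ : ℚ) / DW : ℚ)) : ℝ)) = w := by funext σ; rw [hw]; push_cast; rfl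
    rwa [this] at h
  have hw0 : ∀ σ, 0 ≤ w σ := fun σ => by rw [hw]; positivity
  -- boxes: `z ∈ [-4,4]^t`, `u ∈ [-8,8]^t` ⇒ `z - u ∈ [-12,12]^t`
  have hzu : ∀ z ∈ boxList t 4, ∀ u ∈ boxList t 8, z - u ∈ boxList t 12 := by
    intro z hz u hu
    rw [mem_boxList] at hz hu ⊢
    intro i
    have h1 := hz i; have h2 := hu i
    simp only [Pi.sub_apply]
    push_cast at h1 h2 ⊢
    constructor <;> omega
  have hYb : ∀ z, z ∈ Box t 4 → z ∈ boxList t 4 := fun z hz => by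
    rwa [Box_eq_toFinset t 4, List.mem_toFinset] at hz
  -- the potential, extended by zero outside `[-4,4]^t`, and the tables over `ℝ`
  set φ : (Fin t → ℤ) → ℝ := fun y => if y ∈ boxList t 4 then (Φn y : ℝ) / DΦ else 0 with hφdef
  have hφ0 : ∀ y, 0 ≤ φ y := fun y => by
    rw [hφdef]; dsimp only; split_ifs
    · positivity
    · exact le_rfl
  have hφin : ∀ y ∈ boxList t 4, φ y = (Φn y : ℝ) / DΦ := fun y hy => by rw [hφdef]; dsimp only; rw [if_pos hy]
  set V0f : (Fin t → ℤ) → ℝ := fun u => (V0n u : ℝ) / ((DG * DΦ : ℕ) : ℝ) with hV0f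
  set V1f : (Fin t → ℤ) → ℝ := fun u => (V1n u : ℝ) / ((DG * DΦ : ℕ) : ℝ) with hV1f
  -- Green tables over `ℝ`
  have hG0' : ∀ z ∈ boxList t 4, ∀ u ∈ boxList t 8,
      G0H k a₁ a₂ N (z - u) + (Tn : ℝ) / DG ≤ (((G0n (canonK (z - u)) : ℝ) + Tn) / DG) := by
    intro z hz u hu
    rw [add_div]
    refine add_le_add ?_ le_rfl
    rw [← G0H_canonK, le_div_iff₀ hDGR, ha₁', ha₂']
    exact hG0 _ (hCL _ (hzu z hz u hu))
  have hG1' : ∀ z ∈ boxList t 4, ∀ u ∈ boxList t 8,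
      G1H k a₁ a₂ N (z - u) + (Tn : ℝ) / DG ≤ (((G1n (canonK (z - u)) : ℝ) + Tn) / DG) := by
    intro z hz u hu
    rw [add_div]
    refine add_le_add ?_ le_rfl
    rw [← G1H_canonK, le_div_iff₀ hDGR, ha₁', ha₂']
    exact hG1 _ (hCL _ (hzu z hz u hu))
  -- the potential tables over `ℝ`
  have hVgen : ∀ (Gr : (Fin t → ℤ) → ℝ) (Gn Vn : (Fin t → ℤ) → ℕ),
      (∀ z ∈ boxList t 4, ∀ u ∈ boxList t 8, Gr (z - u) + (Tn : ℝ) / DG ≤ (((Gn (canonK (z - u)) : ℝ) + Tn) / DG)) →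
      (∀ u ∈ boxList t 8, 1 + ((boxList t 4).map fun z => (Gn (canonK (z - u)) + Tn) * Φn z).sum ≤ Vn u) →
      ∀ u ∈ Box t 8, (1 / ((DG * DΦ : ℕ) : ℝ) + ∑ z ∈ Box t 4, (Gr (z - u) + (Tn : ℝ) / DG) * φ z) ≤
        (Vn u : ℝ) / ((DG * DΦ : ℕ) : ℝ) := by
    intro Gr Gn Vn hGr hVn u hu
    rw [Box_eq_toFinset, List.mem_toFinset] at hu
    have hsum : ∑ z ∈ Box t 4, (Gr (z - u) + (Tn : ℝ) / DG) * φ z ≤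
        ∑ z ∈ Box t 4, ((((Gn (canonK (z - u)) : ℝ) + Tn) / DG) * ((Φn z : ℝ) / DΦ)) :=
      sum_le_sum fun z hz => by
        rw [hφin z (hYb z hz)]
        exact mul_le_mul_of_nonneg_right (hGr z (hYb z hz) u hu) (by positivity)
    have hcast : ((Vn u : ℝ)) ≥ ((1 + ((boxList t 4).map fun z => (Gn (canonK (z - u)) + Tn) * Φn z).sum : ℕ) : ℝ) := by
      exact_mod_cast hVn u hu
    rw [cast_boxSum4] at hcast
    have heq : ∑ z ∈ Box t 4, ((((Gn (canonK (z - u)) : ℝ) + Tn) / DG) * ((Φn z : ℝ) / DΦ)) =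
        (∑ z ∈ Box t 4, (((Gn (canonK (z - u)) : ℝ) + Tn) * Φn z)) / ((DG * DΦ : ℕ) : ℝ) := by
      rw [Finset.sum_div]
      exact sum_congr rfl fun z _ => by push_cast; ring
    rw [heq] at hsum
    have hpos : (0 : ℝ) < ((DG * DΦ : ℕ) : ℝ) := by positivity
    calc 1 / ((DG * DΦ : ℕ) : ℝ) + ∑ z ∈ Box t 4, (Gr (z - u) + (Tn : ℝ) / DG) * φ z
        ≤ (1 + ∑ z ∈ Box t 4, (((Gn (canonK (z - u)) : ℝ) + Tn) * Φn z)) / ((DG * DΦ : ℕ) : ℝ) := by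
          rw [add_div]; exact add_le_add le_rfl hsum
      _ ≤ (Vn u : ℝ) / ((DG * DΦ : ℕ) : ℝ) := div_le_div_of_nonneg_right hcast hpos.le
  have hV0' : ∀ u ∈ Box t 8, V0H k a₁ a₂ N ((Tn : ℝ) / DG) (1 / ((DG * DΦ : ℕ) : ℝ)) φ u ≤ V0f u :=
    hVgen (G0H k a₁ a₂ N) G0n V0n hG0' hV0
  have hV1' : ∀ u ∈ Box t 8, V1H k a₁ a₂ N ((Tn : ℝ) / DG) (1 / ((DG * DΦ : ℕ) : ℝ)) φ u ≤ V1f u :=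
    hVgen (G1H k a₁ a₂ N) G1n V1n hG1' hV1
  have hT' : TailBoundH t k a₁ a₂ N ((Tn : ℝ) / DG) := by rw [ha₁', ha₂']; exact hT
  -- the certificate inequalities over `ℝ`
  have hx : (1 / ((P : ℝ) / 10000)) = ((10000 : ℕ) : ℝ) / P := by push_cast; field_simp
  have hcert' : ∀ y ∈ Box t 4, certLHSV pc w k (1 / ((P : ℝ) / 10000)) V0f V1f y ≤ φ y := by
    intro y hy
    replace hy := hYb y hy
    have h := (Int.cast_mono (R := ℝ)) (hcert y hy)
    have hSt' : certLHSVz pe St W k 10000 P E V0n V1n y = certLHSVz pe (SV pc k) W k 10000 P E V0n V1n y := by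
      unfold certLHSVz; simp only [hSt y hy]
    rw [hSt'] at h
    push_cast at h
    rw [certLHSVz_cast pc hpe W (by omega) 10000 hP0 hE V0n V1n y hDW (by positivity : 0 < DG * DΦ)] at h
    rw [hx, hφin y hy]
    rw [hw, hV0f, hV1f]
    push_cast at h ⊢
    have hMpos : (0 : ℝ) < (k : ℝ) * (P : ℝ) ^ E * (DW : ℝ) ^ 2 * ((DG : ℝ) * DΦ) * DΦ := by positivity
    refine le_of_mul_le_mul_right ?_ hMpos
    calc _ = certLHSV pc (fun σ => (W σ : ℝ) / DW) k ((10000 : ℝ) / P) (fun u => (V0n u : ℝ) / ((DG : ℝ) * DΦ))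
          (fun u => (V1n u : ℝ) / ((DG : ℝ) * DΦ)) y * ((k : ℝ) * (P : ℝ) ^ E * (DW : ℝ) ^ 2 * ((DG : ℝ) * DΦ)) * DΦ := by
          ring
      _ ≤ (Φn y : ℝ) * ((P : ℝ) ^ E * k * (DW : ℝ) ^ 2 * ((DG : ℝ) * DΦ)) := h
      _ = _ := by field_simp
  exact siteCriticalProb_le_of_cert5V hk hcube hvc hmarg' hw0 hp0 hp1 hT' (by positivity) φ hφ0 hV0' hV1' hcert'

end Summit.CriticalPhenomena.PercolationContinuityZ3.Theorems.Pcint.BSMX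

end
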